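import Summits.KontsevichZagierPeriods.KontsevichZagierPeriods.Theses.HurwitzMicroSectors
import Summits.KontsevichZagierPeriods.KontsevichZagierPeriods.Theorems.HurwitzMicroSectorsNormalFormPrinciplePiBoxTransfer

/-! TTRL-lite variant V2350 of stmt-KontsevichZagierPeriods-3869

Variant V2350 = `stub_boxRigidity` (BoxRigidity: two box-rational representations — domain the open
unit box, integrand `p/q` over `ℚ` — with equal values are KZ-equivalent) under the JOINT small-case move
`bound_nat:m≤2; bound_nat:m'≤3` (the mirror image of V2239, `bound_nat:m≤3; bound_nat:m'≤2`). Verdict of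
the attempt seat: **open** — this file is the exact-strength certificate, not a proof of the variant.
As for every joint bound (`boxRigidityLe_iff_boxVanishing`, file `…Variants2239`: `m ≤ j, m' ≤ k` is
BoxVanishing in the single dimension `max j k`), V2350 is EQUIVALENT to BoxVanishing in dimension `3` —
every box-rational representation on `(0,1)³` of value `0` is a relation, i.e. Conjecture 1 for
box-rational periods of dimension `3`
(`stub_boxRigidity_var2350_iff_boxVanishing_three`, proved here self-containedly from `pad_le` /
`sub_same`), hence to V2239 (`stub_boxRigidity_var2239_iff_boxVanishing_three`, same right-hand side)
and to BoxRigidity with `m, m' ≤ 3` (which side carries which bound is idle). Already its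
dimension-`2` consequence (`boxVanishing_two_of_stub_boxRigidity_var2350`) decides every `ℚ`-linear
relation among the periods `∫∫_{(0,1)²} p/q` (`π log 2`, `log² 2`, Catalan's `G = ∫∫ dx dy/(1+x²y²)`,
`Li₂` and Clausen values, …) in favour of the calculus; no argument in the tree or in print proves or
refutes that, and `KontsevichZagierPeriods → V2350` (`stub_boxRigidity_var2350_of_statement`), so a
refutation of the variant would refute the Summit. The two-sided instance `m, m' ≤ 1` is the theorem
`boxRigidity_of_le_one` (Baker, sorry-free in tree); dimension `2` is the first open one, so no joint
bound with `max ≥ 2` is reachable by the small-case move.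
Source: M. Kontsevich, D. Zagier, *Periods* (2001), §1.2 Conjecture 1 and rules 1)–3).
Pure proof file, no definitions. -/

-- `Summit.<Summit>.<Problem>` is the tree's mandated summit-side namespace (CONVENTIONS §2); for this
-- single-conjunct summit the two coincide, so the duplicate is deliberate.
set_option linter.dupNamespace false

noncomputable section

namespace Summit.KontsevichZagierPeriods.KontsevichZagierPeriods.Theorems

open MeasureTheory Set
open Literature.NumberTheory.Transcendental Literature.NumberTheory.Transcendental.KZ
open Summit.KontsevichZagierPeriods.KontsevichZagierPeriods.Theses.HurwitzMicroSectors
open Summit.KontsevichZagierPeriods.HurwitzMicroSectors.NormalFormPrinciple.PiBox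
open Summit.KontsevichZagierPeriods.HurwitzMicroSectors.NormalFormPrinciple.PiBox.stub_boxCombineAux

/-! ## The variant V2350: Conjecture 1 for box-rational periods of dimension 3 -/

/-- **V2350 ⟺ BoxVanishing in dimension `3`** (every box-rational representation on `(0,1)³` of value
`0` is a relation): compare a box-rational representation on `(0,1)³` of value `0` (right slot,
`m' = 3`) with the zero representation on the `0`-box (left slot, `m = 0`), itself a relation;
conversely pad both representations to `(0,1)³` (`pad_le`: Newton–Leibniz + null faces) and subtract the
integrands (`sub_same`, rule 1b)); the difference has value `0` by soundness, hence is a relation.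
[cite: KontsevichZagier2001, §1.2 Conjecture 1] -/
theorem stub_boxRigidity_var2350_iff_boxVanishing_three :
    (∀ (m m' : ℕ) (N : IntegralRep m) (N' : IntegralRep m'), m ≤ 2 → m' ≤ 3 → N.domain = {x | ∀ i, x i ∈ Set.Ioo (0:ℝ) 1} → N.IsRational → N'.domain = {x | ∀ i, x i ∈ Set.Ioo (0:ℝ) 1} → N'.IsRational → N.value = N'.value → Equivalent N N') ↔
    (∀ N : IntegralRep 3, N.domain = {x | ∀ i, x i ∈ Set.Ioo (0:ℝ) 1} → N.IsRational →
      N.value = 0 → of N ∈ relations) := by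
  constructor
  · intro h N hNd hNr hv
    obtain ⟨Z, hZd, hZi⟩ := exists_zeroRep (isSemialgebraic_box 0)
    have hZ : of Z ∈ relations := of_mem_relations_of_eqOn_zero Z (by simp [hZi, EqOn])
    have hZv : Z.value = 0 := by simp [IntegralRep.value, hZi]
    have hZr : Z.IsRational := ⟨0, 1, fun x _ => by simp, fun x _ => by simp [hZi]⟩
    have hZN : of Z - of N ∈ relations :=
      h 0 3 Z N (Nat.zero_le 2) le_rfl hZd hZr hNd hNr (by rw [hv, hZv])
    have := relations.sub_mem hZ hZN
    rwa [sub_sub_cancel] at this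
  · intro hvan m m' N N' hm hm' hNd hNr hN'd hN'r hv
    obtain ⟨R₁, h₁d, h₁r, h₁⟩ := pad_le (hm.trans (by norm_num : 2 ≤ 3)) N hNd hNr
    obtain ⟨R₂, h₂d, h₂r, h₂⟩ := pad_le hm' N' hN'd hN'r
    obtain ⟨M, hMd, hMr, hM⟩ := sub_same R₁ R₂ h₁d h₁r h₂d h₂r
    have hMv : M.value = 0 := by
      have e₁ := relations_le_ker_eval_holds h₁
      have e₂ := relations_le_ker_eval_holds h₂
      have e := relations_le_ker_eval_holds hM
      simp only [AddMonoidHom.mem_ker, map_sub, eval_of] at e₁ e₂ e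
      linarith
    have e : of N - of N' = (of N - of R₁) - (of N' - of R₂) + (of R₁ - of R₂ - of M) + of M := by
      abel
    show of N - of N' ∈ relations
    rw [e]
    exact relations.add_mem (relations.add_mem (relations.sub_mem h₁ h₂) hM) (hvan M hMd hMr hMv)

/-- **V2350 ⇒ BoxVanishing in dimension `2`** (left slot `m = 2` against the zero representation on the
`0`-box): the variant already decides every `ℚ`-linear relation among the box periods `∫∫_{(0,1)²} p/q`
(`π log 2`, `log² 2`, Catalan's `G`, `Li₂` and Clausen values, …) in favour of the calculus — the first
dimension where this is open. [cite: KontsevichZagier2001, §1.2 Conjecture 1] -/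
theorem boxVanishing_two_of_stub_boxRigidity_var2350
    (h : ∀ (m m' : ℕ) (N : IntegralRep m) (N' : IntegralRep m'), m ≤ 2 → m' ≤ 3 → N.domain = {x | ∀ i, x i ∈ Set.Ioo (0:ℝ) 1} → N.IsRational → N'.domain = {x | ∀ i, x i ∈ Set.Ioo (0:ℝ) 1} → N'.IsRational → N.value = N'.value → Equivalent N N')
    (N : IntegralRep 2) (hNd : N.domain = {x | ∀ i, x i ∈ Set.Ioo (0:ℝ) 1}) (hNr : N.IsRational)
    (hv : N.value = 0) : of N ∈ relations := by
  obtain ⟨Z, hZd, hZi⟩ := exists_zeroRep (isSemialgebraic_box 0)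
  have hZ : of Z ∈ relations := of_mem_relations_of_eqOn_zero Z (by simp [hZi, EqOn])
  have hZv : Z.value = 0 := by simp [IntegralRep.value, hZi]
  have hZr : Z.IsRational := ⟨0, 1, fun x _ => by simp, fun x _ => by simp [hZi]⟩
  have hNZ : of N - of Z ∈ relations :=
    h 2 0 N Z le_rfl (Nat.zero_le 3) hNd hNr hZd hZr (by rw [hv, hZv])
  simpa using relations.add_mem hNZ hZ

/-- **`KontsevichZagierPeriods ⇒ V2350`**: the variant is a special case of Conjecture 1 for the
tree's calculus — so a refutation of the variant would refute the Summit.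
[cite: KontsevichZagier2001, §1.2 Conjecture 1] -/
theorem stub_boxRigidity_var2350_of_statement (h : _root_.KontsevichZagierPeriods) :
    ∀ (m m' : ℕ) (N : IntegralRep m) (N' : IntegralRep m'), m ≤ 2 → m' ≤ 3 → N.domain = {x | ∀ i, x i ∈ Set.Ioo (0:ℝ) 1} → N.IsRational → N'.domain = {x | ∀ i, x i ∈ Set.Ioo (0:ℝ) 1} → N'.IsRational → N.value = N'.value → Equivalent N N' :=
  fun m m' N N' _ _ => (leaves_of_statement h).1 m m' N N'

/-- **The parent leaf ⇒ V2350** (the variant is a specialisation of `stub_boxRigidity`; the converse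
is not claimed — the parent is BoxVanishing in ALL dimensions). [cite: KontsevichZagier2001, §1.2 Conjecture 1] -/
theorem stub_boxRigidity_var2350_of_parent
    (h : ∀ (m m' : ℕ) (N : IntegralRep m) (N' : IntegralRep m'), N.domain = {x | ∀ i, x i ∈ Set.Ioo (0:ℝ) 1} → N.IsRational → N'.domain = {x | ∀ i, x i ∈ Set.Ioo (0:ℝ) 1} → N'.IsRational → N.value = N'.value → Equivalent N N') :
    ∀ (m m' : ℕ) (N : IntegralRep m) (N' : IntegralRep m'), m ≤ 2 → m' ≤ 3 → N.domain = {x | ∀ i, x i ∈ Set.Ioo (0:ℝ) 1} → N.IsRational → N'.domain = {x | ∀ i, x i ∈ Set.Ioo (0:ℝ) 1} → N'.IsRational → N.value = N'.value → Equivalent N N' :=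
  fun m m' N N' _ _ => h m m' N N'

end Summit.KontsevichZagierPeriods.KontsevichZagierPeriods.Theorems
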